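import Mathlib
import HarnessLib.Audit

/-!
# The weighted Caro–Wei bound (tool for the pair-compatibility bookends of X1 `FoolingMeasure`)

FRONTIER restricted-model rung (AEA cut rectangles vs NON-3-COL, crux `AeaCutRectangles.FoolingMeasure`, cell `pnp-ideate`);
nothing here bears on `P` versus `NP`.

A self-contained weighted Caro–Wei / Turán-type lemma, used by `AeaCutRectanglesSwapBookends` (the LOWER bookend of the planner
seat p4's pair-compatibility analysis, `Cruxes/FoolingMeasure/SwapBookends.lean`): for a finite vertex set `s`, a symmetric
adjacency relation and non-negative weights `w`, some INDEPENDENT subset `t ⊆ s` has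
`Σ_{a ∈ s} w(a) / (deg_s(a) + 1) ≤ Σ_{a ∈ t} w(a)` (`exists_independent_ge`).  Proof (deterministic, greedy): the quantities
`φ(a) = w(a) − Σ_{b ∈ N_s[a]} w(b)/(deg_s(b)+1)` sum to `0` over `s` (double counting over closed neighbourhoods), so some `a₀` has
`φ(a₀) ≥ 0`; put `a₀` in the set and recurse on `s ∖ N_s[a₀]`, where degrees only went down.
-/

set_option linter.dupNamespace false

open Finset

namespace Summit.PneNP.PneNP.Theorems.AeaCutRectanglesCaroWei

variable {α : Type*} [DecidableEq α] (adj : α → α → Prop) [DecidableRel adj]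

/-- Degree of `a` inside `s`: the number of OTHER members of `s` adjacent to `a`. -/
def degIn (s : Finset α) (a : α) : ℕ := (s.filter fun b => b ≠ a ∧ adj a b).card

/-- Closed neighbourhood of `a` inside `s`. -/
def closedNbhd (s : Finset α) (a : α) : Finset α := s.filter fun b => b = a ∨ adj a b

/-- The Caro–Wei potential `Σ_{a ∈ s} w(a)/(deg_s(a)+1)`. -/
noncomputable def potential (s : Finset α) (w : α → ℝ) : ℝ := ∑ a ∈ s, w a / (degIn adj s a + 1)

omit [DecidableEq α] in
/-- The closed neighbourhood has `deg + 1` members (for `a ∈ s`). -/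
theorem card_closedNbhd {s : Finset α} {a : α} (ha : a ∈ s) [DecidableEq α] :
    (closedNbhd adj s a).card = degIn adj s a + 1 := by
  unfold closedNbhd degIn
  have hsplit : (s.filter fun b => b = a ∨ adj a b) = insert a (s.filter fun b => b ≠ a ∧ adj a b) := by
    ext b
    simp only [mem_filter, mem_insert]
    constructor
    · rintro ⟨hb, h | h⟩
      · exact Or.inl h
      · by_cases hba : b = a
        · exact Or.inl hba
        · exact Or.inr ⟨hb, hba, h⟩
    · rintro (rfl | ⟨hb, -, h⟩)
      · exact ⟨ha, Or.inl rfl⟩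
      · exact ⟨hb, Or.inr h⟩
  rw [hsplit, card_insert_of_notMem (by simp)]

/-- Degrees inside a subset are not larger. -/
theorem degIn_mono {s s' : Finset α} (h : s' ⊆ s) (a : α) : degIn adj s' a ≤ degIn adj s a :=
  card_le_card (filter_subset_filter _ h)

/-- **Double counting**: `Σ_{a ∈ s} Σ_{b ∈ N_s[a]} w(b)/(deg_s(b)+1) = Σ_{b ∈ s} w(b)` (each `b` lies in exactly `deg_s(b)+1` closed
neighbourhoods, by symmetry). -/
theorem sum_closedNbhd_potential (hsymm : ∀ a b, adj a b → adj b a) (s : Finset α) (w : α → ℝ) :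
    ∑ a ∈ s, ∑ b ∈ closedNbhd adj s a, w b / (degIn adj s b + 1) = ∑ b ∈ s, w b := by
  -- swap the sums: `b ∈ N[a] ↔ a ∈ N[b]`
  have hswap : ∑ a ∈ s, ∑ b ∈ closedNbhd adj s a, w b / (degIn adj s b + 1) =
      ∑ b ∈ s, ∑ a ∈ closedNbhd adj s b, w b / (degIn adj s b + 1) := by
    rw [sum_comm' (t' := s) (s' := fun b => closedNbhd adj s b)]
    intro a b
    unfold closedNbhd
    simp only [mem_filter]
    constructor
    · rintro ⟨ha, hb, h⟩
      refine ⟨⟨ha, ?_⟩, hb⟩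
      rcases h with h | h
      · exact Or.inl h.symm
      · exact Or.inr (hsymm _ _ h)
    · rintro ⟨⟨ha, h⟩, hb⟩
      refine ⟨ha, hb, ?_⟩
      rcases h with h | h
      · exact Or.inl h.symm
      · exact Or.inr (hsymm _ _ h)
  rw [hswap]
  refine sum_congr rfl fun b hb => ?_
  rw [sum_const, card_closedNbhd adj hb, nsmul_eq_mul]
  have hpos : (0 : ℝ) < (degIn adj s b : ℝ) + 1 := by positivity
  rw [Nat.cast_add_one, mul_div_assoc', mul_comm, mul_div_assoc, div_self hpos.ne', mul_one]

/-- **Weighted Caro–Wei.**  For a symmetric adjacency and non-negative weights, some subset of `s` with no two distinct adjacent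
members has total weight at least the potential `Σ_{a ∈ s} w(a)/(deg_s(a)+1)`. -/
theorem exists_independent_ge (hsymm : ∀ a b, adj a b → adj b a) (w : α → ℝ) (hw : ∀ a, 0 ≤ w a) :
    ∀ s : Finset α, ∃ t : Finset α, t ⊆ s ∧ (∀ a ∈ t, ∀ b ∈ t, a ≠ b → ¬ adj a b) ∧ potential adj s w ≤ ∑ a ∈ t, w a := by
  intro s
  induction s using Finset.strongInduction with
  | H s ih =>
    rcases s.eq_empty_or_nonempty with rfl | hne
    · exact ⟨∅, Subset.rfl, by simp, by simp [potential]⟩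
    -- a vertex whose weight pays for the potential of its closed neighbourhood
    set φ : α → ℝ := fun a => w a - ∑ b ∈ closedNbhd adj s a, w b / (degIn adj s b + 1) with hφ
    have hsum : ∑ a ∈ s, φ a = 0 := by
      simp only [hφ, sum_sub_distrib, sum_closedNbhd_potential adj hsymm s w, sub_self]
    obtain ⟨a₀, ha₀, hφa₀⟩ : ∃ a₀ ∈ s, 0 ≤ φ a₀ := by
      by_contra hno
      push Not at hno
      have : ∑ a ∈ s, φ a < ∑ a ∈ s, (0 : ℝ) := sum_lt_sum_of_nonempty hne fun a ha => hno a ha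
      rw [sum_const_zero, hsum] at this
      exact lt_irrefl _ this
    -- recurse outside the closed neighbourhood of `a₀`
    set s' := s \ closedNbhd adj s a₀ with hs'
    have hss : s' ⊂ s := by
      refine ⟨sdiff_subset, fun h => ?_⟩
      have : a₀ ∈ s' := h ha₀
      rw [hs', mem_sdiff] at this
      exact this.2 (by unfold closedNbhd; exact mem_filter.2 ⟨ha₀, Or.inl rfl⟩)
    obtain ⟨t', ht's', hind', hpot'⟩ := ih s' hss
    refine ⟨insert a₀ t', ?_, ?_, ?_⟩
    · exact insert_subset ha₀ (ht's'.trans sdiff_subset)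
    · intro a ha b hb hab
      rw [mem_insert] at ha hb
      have key : ∀ c ∈ t', ¬ adj a₀ c := by
        intro c hc h
        have hc' := ht's' hc
        rw [hs', mem_sdiff] at hc'
        exact hc'.2 (by unfold closedNbhd; exact mem_filter.2 ⟨hc'.1, Or.inr h⟩)
      rcases ha with rfl | ha
      · rcases hb with rfl | hb
        · exact absurd rfl hab
        · exact key b hb
      · rcases hb with rfl | hb
        · exact fun h => key a ha (hsymm _ _ h)
        · exact hind' a ha b hb hab
    · -- potential bookkeeping
      have ha₀t' : a₀ ∉ t' := fun h => by
        have := ht's' h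
        rw [hs', mem_sdiff] at this
        exact this.2 (by unfold closedNbhd; exact mem_filter.2 ⟨ha₀, Or.inl rfl⟩)
      rw [sum_insert ha₀t']
      have hsplit : potential adj s w =
          ∑ b ∈ closedNbhd adj s a₀, w b / (degIn adj s b + 1) + ∑ a ∈ s', w a / (degIn adj s a + 1) := by
        unfold potential
        rw [hs', ← sum_sdiff (show closedNbhd adj s a₀ ⊆ s from filter_subset _ _), add_comm]
      have h1 : ∑ b ∈ closedNbhd adj s a₀, w b / (degIn adj s b + 1) ≤ w a₀ := by
        have : 0 ≤ φ a₀ := hφa₀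
        simp only [hφ] at this
        linarith
      have h2 : ∑ a ∈ s', w a / (degIn adj s a + 1) ≤ potential adj s' w := by
        unfold potential
        refine sum_le_sum fun a _ => ?_
        have hd : (degIn adj s' a : ℝ) + 1 ≤ degIn adj s a + 1 := by
          have := degIn_mono adj (sdiff_subset : s' ⊆ s) a
          exact_mod_cast Nat.add_le_add_right this 1
        exact div_le_div_of_nonneg_left (hw a) (by positivity) hd
      linarith [hsplit, h1, h2, hpot']

end Summit.PneNP.PneNP.Theorems.AeaCutRectanglesCaroWei
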